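import Mathlib

/-!
# Combinatorics of the strong-coupling (high-temperature) polymer expansion

Trunk: ConstructiveQFT (family `constructive-qft`); support file for the proofs of the
Osterwalder–Seiler strong-coupling results of `Sweep1` (item S14: existence of the
thermodynamic limit and Wilson's area law for lattice gauge theory at small `β`), file
`Literature/MathematicalPhysics/QuantumFieldTheory/Sweep1AreaLawProofs.lean`.

This file isolates the purely combinatorial part of the elementary strong-coupling bounds on
expectations `⟨F⟩_Λ = (∑_{Q ⊆ P} I Q) / (∑_{Q ⊆ P} J Q)` obtained by expanding a Gibbs factor
`∏_{p ∈ P} (1 + λ_p)` with *non-negative* activities `λ_p` (Osterwalder–Seiler, Ann. Phys. 110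
(1978) 440, §3 and §5; Seiler, LNP 159 (1982), Ch. 3), in an abstract form: a finite "universe"
of polymers (plaquettes) `P : Finset ι` with an adjacency relation `adj` (sharing a bond), a set
of *seeds* `S` (the plaquettes touching the support of the observable), and

* `IsSeeded adj S A`: every element of `A` is connected to a seed inside `A` (every connected
  component of `A` meets `S`; the supports of the expansion terms attached to the observable);
* `seededComponent adj S Q`: the part of `Q` connected to the seeds inside `Q`;
* `sum_pow_card_le_of_isSeeded` (the lattice-animal / Peierls counting bound): if every polymer
  has at most `D` neighbours then `∑_{A ⊆ P seeded by S} x^{|A|} ≤ 2^{|S|}` for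
  `0 ≤ x ≤ 2^{-D}`, uniformly in `P`;
* `abs_sum_powerset_le` (domination by positivity): if a function on subsets of `P` factorises
  as `F Q = I (comp Q) * J (Q \ comp Q)` through the seeded component with `J ≥ 0`, then
  `|∑_Q F Q| ≤ (∑_{A seeded} |I A|) * ∑_B J B`;
* `apply_lt_add_card_of_isSeeded` (discrete intermediate value property): if a level function
  changes by at most `1` across `adj` and is `≤ n₀` on the seeds, a seeded set reaching level `n`
  has more than `n - n₀` elements (boundary clusters are large);
* `abs_sub_le_of_factor`, `abs_div_sub_div_le_of_factor` (two-volume comparison): for `P ⊆ P'`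
  and set functions `I`, `J ≥ 0` which split off non-adjacent seedless co-factors,
  `|N_{P'}/Z_{P'} - N_P/Z_P|` (`N = ∑ I`, `Z = ∑ J`) is bounded by a sum over the seeded
  `A ⊆ P'` *not* contained in `P`: in the double expansion of `Z_P N_{P'} - N_P Z_{P'}` the pairs
  `(Q, Q')` whose joint seeded component stays inside `P` cancel in pairs under the exchange of
  their seeded parts (`Finset.sum_involution`), and the rest is dominated by positivity. This is
  an elementary substitute, sufficient for the existence of the thermodynamic limit, for the
  convergent cluster expansion of Osterwalder–Seiler 1978 Thm. 3.6.

All statements here are elementary finite combinatorics and are proved in full. [folklore]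
-/

namespace Literature.MathematicalPhysics.QuantumFieldTheory.Polymer

open Finset Relation

variable {ι : Type*} (adj : ι → ι → Prop)

/-- Adjacency *inside* the finite set `A`: both endpoints lie in `A` and are adjacent. [folklore] -/
def AdjIn (A : Finset ι) (a b : ι) : Prop := a ∈ A ∧ b ∈ A ∧ adj a b

/-- `A` is *seeded* by `S`: every element of `A` can be reached from some element of `A ∩ S`
by a chain of adjacent elements of `A` (every connected component of `A` meets `S`). [folklore] -/
def IsSeeded (S : Finset ι) (A : Finset ι) : Prop :=
  ∀ p ∈ A, ∃ q ∈ A, q ∈ S ∧ ReflTransGen (AdjIn adj A) q p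

variable {adj}

/-- Adjacency inside a set is monotone in the set. [folklore] -/
theorem AdjIn.mono {A B : Finset ι} (h : A ⊆ B) {a b : ι} (hab : AdjIn adj A a b) :
    AdjIn adj B a b :=
  ⟨h hab.1, h hab.2.1, hab.2.2⟩

/-- Chains inside a set are chains inside any larger set. [folklore] -/
theorem reflTransGen_adjIn_mono {A B : Finset ι} (h : A ⊆ B) {a b : ι}
    (hab : ReflTransGen (AdjIn adj A) a b) : ReflTransGen (AdjIn adj B) a b :=
  ReflTransGen.mono (fun _ _ (hxy : AdjIn adj A _ _) => hxy.mono h) _ _ hab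

/-- The endpoint of a chain inside `A` starting in `A` lies in `A`. [folklore] -/
theorem mem_of_reflTransGen_adjIn {A : Finset ι} {a b : ι} (ha : a ∈ A)
    (hab : ReflTransGen (AdjIn adj A) a b) : b ∈ A := by
  induction hab with
  | refl => exact ha
  | tail _ hbc _ => exact hbc.2.1

/-- The empty set is seeded by anything. [folklore] -/
theorem isSeeded_empty (S : Finset ι) : IsSeeded adj S (∅ : Finset ι) := by
  intro p hp; simp at hp

/-- A seeded set with no seed available is empty. [folklore] -/
theorem eq_empty_of_isSeeded {S A : Finset ι} (hA : IsSeeded adj S A)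
    (h : ∀ q ∈ A, q ∉ S) : A = ∅ := by
  rcases A.eq_empty_or_nonempty with hA' | ⟨p, hp⟩
  · exact hA'
  · obtain ⟨q, hqA, hqS, -⟩ := hA p hp
    exact ((h q hqA) hqS).elim

/-- Removing from the seed set an element not in `A` does not change seededness. [folklore] -/
theorem isSeeded_erase_iff [DecidableEq ι] {S A : Finset ι} {s : ι} (hs : s ∉ A) :
    IsSeeded adj (S.erase s) A ↔ IsSeeded adj S A := by
  constructor
  · intro h p hp
    obtain ⟨q, hqA, hqS, hq⟩ := h p hp
    exact ⟨q, hqA, (mem_erase.mp hqS).2, hq⟩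
  · intro h p hp
    obtain ⟨q, hqA, hqS, hq⟩ := h p hp
    refine ⟨q, hqA, mem_erase.mpr ⟨?_, hqS⟩, hq⟩
    rintro rfl; exact hs hqA

/-- Peeling a seed: if `insert s A` (with `s ∉ A`) is seeded by `S`, then `A` is seeded by
`S \ {s}` together with any finite set `N` containing all neighbours of `s`. [folklore] -/
theorem IsSeeded.of_insert [DecidableEq ι] {S A N : Finset ι} {s : ι} (hs : s ∉ A)
    (hN : ∀ b, adj s b → b ∈ N) (h : IsSeeded adj S (insert s A)) :
    IsSeeded adj (S.erase s ∪ N) A := by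
  intro p hp
  obtain ⟨q, hq, hqS, hqp⟩ := h p (mem_insert_of_mem hp)
  -- generalised claim along the chain
  have key : ∀ p', ReflTransGen (AdjIn adj (insert s A)) q p' →
      p' = s ∨ ∃ q' ∈ A, q' ∈ S.erase s ∪ N ∧ ReflTransGen (AdjIn adj A) q' p' := by
    intro p' hp'
    induction hp' with
    | refl =>
      by_cases hqs : q = s
      · exact Or.inl hqs
      · refine Or.inr ⟨q, ?_, ?_, ReflTransGen.refl⟩
        · exact (mem_insert.mp hq).resolve_left hqs
        · exact mem_union_left _ (mem_erase.mpr ⟨hqs, hqS⟩)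
    | @tail b c _ hbc ih =>
      by_cases hcs : c = s
      · exact Or.inl hcs
      · have hcA : c ∈ A := (mem_insert.mp hbc.2.1).resolve_left hcs
        rcases ih with hb | ⟨q', hq'A, hq'S, hq'b⟩
        · subst hb
          exact Or.inr ⟨c, hcA, mem_union_right _ (hN c hbc.2.2), ReflTransGen.refl⟩
        · have hbA : b ∈ A := mem_of_reflTransGen_adjIn hq'A hq'b
          exact Or.inr ⟨q', hq'A, hq'S, hq'b.tail ⟨hbA, hcA, hbc.2.2⟩⟩
  have hps : p ≠ s := by rintro rfl; exact hs hp
  rcases key p hqp with h' | h'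
  · exact (hps h').elim
  · exact h'


/-! ### The counting bound for seeded sets -/

section Counting

variable [DecidableEq ι]

open scoped Classical in
/-- **Peierls / lattice-animal counting bound.** If every polymer has at most `D` neighbours
(`nbr a` is a finite set containing all `b` with `adj a b`, of size `≤ D`) and
`0 ≤ x ≤ 2^{-D}`, then the generating function of the subsets of `P` seeded by `S` satisfies
`∑_{A ⊆ P, A seeded by S} x^{|A|} ≤ 2^{|S|}`, uniformly in the finite universe `P`
(cf. Seiler, LNP 159 (1982), proof of Thm. 3.2; Osterwalder–Seiler 1978 Lemma 5.2). [folklore] -/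
theorem sum_pow_card_le_of_isSeeded (nbr : ι → Finset ι) (hnbr : ∀ a b, adj a b → b ∈ nbr a)
    (D : ℕ) (hD : ∀ a, #(nbr a) ≤ D) {x : ℝ} (hx0 : 0 ≤ x) (hx : x * 2 ^ D ≤ 1)
    (P S : Finset ι) :
    ∑ A ∈ P.powerset with IsSeeded adj S A, x ^ #A ≤ 2 ^ #S := by
  induction P using Finset.strongInductionOn generalizing S with
  | _ P ih => ?_
  by_cases hPS : ∃ s ∈ P, s ∈ S
  · obtain ⟨s, hsP, hsS⟩ := hPS
    have hP : P = insert s (P.erase s) := (insert_erase hsP).symm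
    have hs' : s ∉ P.erase s := Finset.notMem_erase s P
    have hsub : P.erase s ⊂ P := erase_ssubset hsP
    rw [hP, sum_filter, sum_powerset_insert hs']
    -- first sum: seeded by `S.erase s`
    have h1 : ∑ t ∈ (P.erase s).powerset, (if IsSeeded adj S t then x ^ #t else 0) ≤
        2 ^ #(S.erase s) := by
      have := ih (P.erase s) hsub (S.erase s)
      rw [sum_filter] at this
      refine le_of_eq_of_le (sum_congr rfl fun t ht => ?_) this
      have hst : s ∉ t := fun h => hs' (mem_powerset.mp ht h)
      simp only [isSeeded_erase_iff hst]
    -- second sum: peel `s`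
    have h2 : ∑ t ∈ (P.erase s).powerset,
        (if IsSeeded adj S (insert s t) then x ^ #(insert s t) else 0) ≤
        x * 2 ^ #(S.erase s ∪ nbr s) := by
      have := ih (P.erase s) hsub (S.erase s ∪ nbr s)
      rw [sum_filter] at this
      calc ∑ t ∈ (P.erase s).powerset,
            (if IsSeeded adj S (insert s t) then x ^ #(insert s t) else 0)
          ≤ ∑ t ∈ (P.erase s).powerset,
            x * (if IsSeeded adj (S.erase s ∪ nbr s) t then x ^ #t else 0) := by
            refine sum_le_sum fun t ht => ?_
            have hst : s ∉ t := fun h => hs' (mem_powerset.mp ht h)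
            split_ifs with h1' h2'
            · rw [card_insert_of_notMem hst, pow_succ, mul_comm]
            · exact absurd (h1'.of_insert hst (hnbr s)) h2'
            · positivity
            · simp
        _ = x * ∑ t ∈ (P.erase s).powerset,
            (if IsSeeded adj (S.erase s ∪ nbr s) t then x ^ #t else 0) := by rw [mul_sum]
        _ ≤ x * 2 ^ #(S.erase s ∪ nbr s) := mul_le_mul_of_nonneg_left this hx0
    -- arithmetic
    have hcardS : #S = #(S.erase s) + 1 := (card_erase_add_one hsS).symm
    have hcard2 : #(S.erase s ∪ nbr s) ≤ #(S.erase s) + D :=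
      (card_union_le _ _).trans (Nat.add_le_add_left (hD s) _)
    calc _ ≤ 2 ^ #(S.erase s) + x * 2 ^ #(S.erase s ∪ nbr s) := add_le_add h1 h2
      _ ≤ 2 ^ #(S.erase s) + x * 2 ^ (#(S.erase s) + D) := by
          gcongr
          · norm_num
      _ = 2 ^ #(S.erase s) * (1 + x * 2 ^ D) := by ring
      _ ≤ 2 ^ #(S.erase s) * 2 := by
          refine mul_le_mul_of_nonneg_left ?_ (by positivity)
          linarith
      _ = 2 ^ #S := by rw [hcardS, pow_succ]
  · -- no seed available: only the empty set is seeded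
    push Not at hPS
    have hsub : P.powerset.filter (IsSeeded adj S) ⊆ {∅} := by
      intro A hA
      rw [mem_filter, mem_powerset] at hA
      rw [mem_singleton]
      exact eq_empty_of_isSeeded hA.2 fun q hq => hPS q (hA.1 hq)
    calc ∑ A ∈ P.powerset with IsSeeded adj S A, x ^ #A
        ≤ ∑ A ∈ ({∅} : Finset (Finset ι)), x ^ #A :=
          sum_le_sum_of_subset_of_nonneg hsub fun _ _ _ => by positivity
      _ = 1 := by simp
      _ ≤ 2 ^ #S := one_le_pow₀ (by norm_num)

end Counting

/-! ### The seeded component and domination by positivity -/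

section Component

variable [DecidableEq ι]

variable (adj) in
open scoped Classical in
/-- The *seeded component* of `Q`: the elements of `Q` connected to a seed by a chain of adjacent
elements of `Q` (the union of the connected components of `Q` meeting `S`). [folklore] -/
noncomputable def seededComponent (S Q : Finset ι) : Finset ι :=
  Q.filter fun p => ∃ q ∈ Q, q ∈ S ∧ ReflTransGen (AdjIn adj Q) q p

variable (adj) in
open scoped Classical in
/-- The seeded component of `Q` is contained in `Q`. [folklore] -/
theorem seededComponent_subset (S Q : Finset ι) : seededComponent adj S Q ⊆ Q := by
  unfold seededComponent; exact filter_subset _ _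

open scoped Classical in
/-- Membership in the seeded component, unfolded. [folklore] -/
theorem mem_seededComponent {S Q : Finset ι} {p : ι} :
    p ∈ seededComponent adj S Q ↔
      p ∈ Q ∧ ∃ q ∈ Q, q ∈ S ∧ ReflTransGen (AdjIn adj Q) q p := by
  unfold seededComponent; rw [mem_filter]

variable (adj) in
/-- The seeded component is seeded. [folklore] -/
theorem isSeeded_seededComponent (S Q : Finset ι) :
    IsSeeded adj S (seededComponent adj S Q) := by
  intro p hp
  obtain ⟨-, q, hqQ, hqS, hqp⟩ := (mem_seededComponent).mp hp
  have hqC : q ∈ seededComponent adj S Q :=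
    (mem_seededComponent).mpr ⟨hqQ, q, hqQ, hqS, ReflTransGen.refl⟩
  refine ⟨q, hqC, hqS, ?_⟩
  -- every chain from `q` inside `Q` stays inside the component
  have key : ∀ p', ReflTransGen (AdjIn adj Q) q p' →
      ReflTransGen (AdjIn adj (seededComponent adj S Q)) q p' := by
    intro p' hp'
    induction hp' with
    | refl => exact ReflTransGen.refl
    | @tail b c hqb hbc ih =>
      have hcC : c ∈ seededComponent adj S Q :=
        (mem_seededComponent).mpr ⟨hbc.2.1, q, hqQ, hqS, hqb.tail hbc⟩
      have hbC : b ∈ seededComponent adj S Q := mem_of_reflTransGen_adjIn hqC ih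
      exact ih.tail ⟨hbC, hcC, hbc.2.2⟩
  exact key p hqp

/-- An element of `Q` outside the seeded component is not a seed. [folklore] -/
theorem not_mem_seeds_of_not_mem_seededComponent {S Q : Finset ι} {q : ι} (hq : q ∈ Q)
    (hq' : q ∉ seededComponent adj S Q) : q ∉ S := fun hqS =>
  hq' ((mem_seededComponent).mpr ⟨hq, q, hq, hqS, ReflTransGen.refl⟩)

/-- An element of `Q` outside the seeded component is not adjacent to the component. [folklore] -/
theorem not_adj_of_mem_seededComponent {S Q : Finset ι} {p q : ι}
    (hp : p ∈ seededComponent adj S Q) (hq : q ∈ Q) (hq' : q ∉ seededComponent adj S Q) :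
    ¬ adj p q := by
  intro hpq
  obtain ⟨hpQ, r, hrQ, hrS, hrp⟩ := (mem_seededComponent).mp hp
  exact hq' ((mem_seededComponent).mpr ⟨hq, r, hrQ, hrS, hrp.tail ⟨hpQ, hq, hpq⟩⟩)

/-- A seeded set is its own seeded component. [folklore] -/
theorem seededComponent_eq_self_of_isSeeded {S A : Finset ι} (hA : IsSeeded adj S A) :
    seededComponent adj S A = A := by
  refine (seededComponent_subset adj S A).antisymm fun p hp => ?_
  obtain ⟨q, hqA, hqS, hqp⟩ := hA p hp
  exact (mem_seededComponent).mpr ⟨hp, q, hqA, hqS, hqp⟩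

open scoped Classical in
/-- **Domination by positivity.** If a function of the subsets `Q ⊆ P` factorises through the
seeded component, `F Q = I (comp Q) * J (Q \ comp Q)` with `J ≥ 0`, then
`|∑_{Q ⊆ P} F Q| ≤ (∑_{A ⊆ P seeded} |I A|) * ∑_{B ⊆ P} J B`. In the application `F Q`,
`I A` and `J B` are the integrals `∫ W λ^Q`, `∫ W λ^A`, `∫ λ^B` of products of non-negative
plaquette activities against a Wilson loop `W`, and the right-hand side is
`(∑_{A seeded} |∫ W λ^A|) · ∫ ∏ (1 + λ_p)`. [folklore] -/
theorem abs_sum_powerset_le (P S : Finset ι) (I J F : Finset ι → ℝ)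
    (hJ : ∀ B ⊆ P, 0 ≤ J B)
    (hF : ∀ Q ⊆ P, F Q = I (seededComponent adj S Q) * J (Q \ seededComponent adj S Q)) :
    |∑ Q ∈ P.powerset, F Q| ≤
      (∑ A ∈ P.powerset with IsSeeded adj S A, |I A|) * ∑ B ∈ P.powerset, J B := by
  set comp := seededComponent adj S with hcomp
  set T := P.powerset.filter (IsSeeded adj S) with hT
  have hmaps : ∀ Q ∈ P.powerset, comp Q ∈ T := fun Q hQ =>
    mem_filter.mpr ⟨mem_powerset.mpr ((seededComponent_subset adj S Q).trans (mem_powerset.mp hQ)),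
      isSeeded_seededComponent adj S Q⟩
  calc |∑ Q ∈ P.powerset, F Q| ≤ ∑ Q ∈ P.powerset, |F Q| := abs_sum_le_sum_abs _ _
    _ = ∑ Q ∈ P.powerset, |I (comp Q)| * J (Q \ comp Q) := by
        refine sum_congr rfl fun Q hQ => ?_
        have hQP : Q ⊆ P := mem_powerset.mp hQ
        rw [hF Q hQP, abs_mul, abs_of_nonneg (hJ _ (sdiff_subset.trans hQP))]
    _ = ∑ A ∈ T, ∑ Q ∈ P.powerset with comp Q = A, |I (comp Q)| * J (Q \ comp Q) :=
        (sum_fiberwise_of_maps_to hmaps _).symm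
    _ = ∑ A ∈ T, |I A| * ∑ Q ∈ P.powerset with comp Q = A, J (Q \ A) := by
        refine sum_congr rfl fun A _ => ?_
        rw [mul_sum]
        refine sum_congr rfl fun Q hQ => ?_
        rw [(mem_filter.mp hQ).2]
    _ ≤ ∑ A ∈ T, |I A| * ∑ B ∈ P.powerset, J B := by
        refine sum_le_sum fun A _ => mul_le_mul_of_nonneg_left ?_ (abs_nonneg _)
        have hinj : Set.InjOn (fun Q : Finset ι => Q \ A)
            ↑(P.powerset.filter fun Q => comp Q = A) := by
          intro Q₁ h₁ Q₂ h₂ heq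
          have hA₁ : A ⊆ Q₁ := (mem_filter.mp h₁).2 ▸ seededComponent_subset adj S Q₁
          have hA₂ : A ⊆ Q₂ := (mem_filter.mp h₂).2 ▸ seededComponent_subset adj S Q₂
          have : Q₁ \ A ∪ A = Q₂ \ A ∪ A := by simp only at heq; rw [heq]
          rwa [sdiff_union_of_subset hA₁, sdiff_union_of_subset hA₂] at this
        calc ∑ Q ∈ P.powerset with comp Q = A, J (Q \ A)
            = ∑ B ∈ (P.powerset.filter fun Q => comp Q = A).image (fun Q => Q \ A), J B :=
              (sum_image hinj).symm
          _ ≤ ∑ B ∈ P.powerset, J B := by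
              refine sum_le_sum_of_subset_of_nonneg ?_ fun B hB _ => hJ B (mem_powerset.mp hB)
              intro B hB
              obtain ⟨Q, hQ, rfl⟩ := mem_image.mp hB
              exact mem_powerset.mpr
                (sdiff_subset.trans (mem_powerset.mp (mem_filter.mp hQ).1))
    _ = (∑ A ∈ T, |I A|) * ∑ B ∈ P.powerset, J B := by rw [sum_mul]

end Component

/-! ### Level sets along chains: seeded sets reaching far are large -/

section Level

/-- **Discrete intermediate value property.** If a level function `r` increases by at most `1`
along the adjacency relation, then along a chain inside `A` from `q` to `p` every level between
`r q` and `r p` is attained in `A`. [folklore] -/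
theorem exists_mem_apply_eq_of_reflTransGen {r : ι → ℕ} (hr : ∀ a b, adj a b → r b ≤ r a + 1)
    {A : Finset ι} {q p : ι} (hq : q ∈ A) (h : ReflTransGen (AdjIn adj A) q p) {m : ℕ}
    (hqm : r q ≤ m) (hmp : m ≤ r p) : ∃ c ∈ A, r c = m := by
  induction h generalizing m with
  | refl => exact ⟨q, hq, le_antisymm hqm hmp⟩
  | @tail b c _ hbc ih =>
    by_cases hmb : m ≤ r b
    · exact ih hqm hmb
    · have h1 := hr b c hbc.2.2
      exact ⟨c, hbc.2.1, by omega⟩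

/-- **Seeded sets reaching level `n` have at least `n - n₀` elements** when all seeds have level
at most `n₀` and the level changes by at most `1` between adjacent elements: precisely
`r p + 1 ≤ n₀ + |A|` for every `p` in a seeded set `A`. [folklore] -/
theorem apply_lt_add_card_of_isSeeded [DecidableEq ι] {r : ι → ℕ}
    (hr : ∀ a b, adj a b → r b ≤ r a + 1) {S A : Finset ι} (hA : IsSeeded adj S A) {n₀ : ℕ}
    (hS : ∀ s ∈ S, r s ≤ n₀) {p : ι} (hp : p ∈ A) : r p < n₀ + #A := by
  obtain ⟨q, hqA, hqS, hqp⟩ := hA p hp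
  have hq0 := hS q hqS
  by_cases hle : r q ≤ r p
  · -- all levels in `[r q, r p]` are attained in `A`
    have hsub : Finset.Icc (r q) (r p) ⊆ A.image r := by
      intro m hm
      rw [Finset.mem_Icc] at hm
      obtain ⟨c, hcA, hc⟩ := exists_mem_apply_eq_of_reflTransGen hr hqA hqp hm.1 hm.2
      exact mem_image.mpr ⟨c, hcA, hc⟩
    have hcard : r p + 1 - r q ≤ #A := by
      calc r p + 1 - r q = #(Finset.Icc (r q) (r p)) := (Nat.card_Icc _ _).symm
        _ ≤ #(A.image r) := card_le_card hsub
        _ ≤ #A := card_image_le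
    omega
  · push Not at hle
    have : 0 < #A := card_pos.mpr ⟨p, hp⟩
    omega

end Level

/-! ### Comparison of two volumes -/

section TwoVolume

variable [DecidableEq ι]

/-- Set algebra of the swap `(Q, Q') ↦ (Q' ∩ A ∪ Q \ A, Q ∩ A ∪ Q' \ A)`: the part inside `A`.
[folklore] -/
theorem inter_union_sdiff_swap_inter (Q Q' A : Finset ι) : (Q' ∩ A ∪ Q \ A) ∩ A = Q' ∩ A := by
  ext x; simp only [mem_inter, mem_union, mem_sdiff]; tauto

/-- Set algebra of the swap: the part outside `A`. [folklore] -/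
theorem inter_union_sdiff_swap_sdiff (Q Q' A : Finset ι) : (Q' ∩ A ∪ Q \ A) \ A = Q \ A := by
  ext x; simp only [mem_inter, mem_union, mem_sdiff]; tauto

/-- Set algebra of the swap: the union of the two swapped sets is `Q ∪ Q'`. [folklore] -/
theorem inter_union_sdiff_swap_union (Q Q' A : Finset ι) :
    (Q' ∩ A ∪ Q \ A) ∪ (Q ∩ A ∪ Q' \ A) = Q ∪ Q' := by
  ext x; simp only [mem_inter, mem_union, mem_sdiff]; tauto

/-- Factorisation of a set function through the seeded component of a superset: if `K` splits off
non-adjacent seedless co-factors (`K (X ∪ B) = K X * J B`), then for `Q ⊆ U`,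
`K Q = K (Q ∩ comp U) * J (Q \ comp U)`. [folklore] -/
theorem apply_eq_mul_of_factor {P' S : Finset ι} {K J : Finset ι → ℝ}
    (hK : ∀ X B, X ⊆ P' → B ⊆ P' → Disjoint X B → (∀ b ∈ B, b ∉ S) →
      (∀ a ∈ X, ∀ b ∈ B, ¬ adj a b) → K (X ∪ B) = K X * J B)
    {Q U : Finset ι} (hQU : Q ⊆ U) (hU : U ⊆ P') :
    K Q = K (Q ∩ seededComponent adj S U) * J (Q \ seededComponent adj S U) := by
  set A := seededComponent adj S U
  conv_lhs => rw [← (sup_inf_sdiff Q A : Q ∩ A ∪ Q \ A = Q)]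
  refine hK _ _ (inter_subset_left.trans (hQU.trans hU)) (sdiff_subset.trans (hQU.trans hU))
    ?_ (fun b hb => ?_) (fun a ha b hb => ?_)
  · exact Finset.disjoint_left.mpr fun x hx hx' => (mem_sdiff.mp hx').2 (mem_inter.mp hx).2
  · rw [mem_sdiff] at hb
    exact not_mem_seeds_of_not_mem_seededComponent (hQU hb.1) hb.2
  · rw [mem_sdiff] at hb
    exact not_adj_of_mem_seededComponent (mem_inter.mp ha).2 (hQU hb.1) hb.2

open scoped Classical in
/-- **Two-volume comparison** (the combinatorial core of the existence of the thermodynamic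
limit at strong coupling). Let `P ⊆ P'` be two finite universes, `I`, `J` set functions which
split off non-adjacent seedless co-factors (`I (X ∪ B) = I X * J B`, `J (X ∪ B) = J X * J B`)
with `J ≥ 0`, and `Z_P = ∑_{Q ⊆ P} J Q`, `N_P = ∑_{Q ⊆ P} I Q`. Then
`|Z_P N_{P'} - N_P Z_{P'}| ≤ (∑_{A} ∑_{X ∪ Y = A} |J X I Y - I X J Y|) Z_P Z_{P'}`, the outer
sum running over the seeded `A ⊆ P'` *not* contained in `P`: in the double expansion of the
left-hand side, the pairs `(Q, Q')` whose joint seeded component stays inside `P` cancel in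
pairs under the exchange of their seeded parts. In the application `I Q = ∫ F λ^Q`,
`J Q = ∫ λ^Q` and `N_P / Z_P = ⟨F⟩_P`. [folklore] -/
theorem abs_sub_le_of_factor (P P' S : Finset ι) (hPP' : P ⊆ P') (I J : Finset ι → ℝ)
    (hJ : ∀ B ⊆ P', 0 ≤ J B)
    (hIfac : ∀ X B, X ⊆ P' → B ⊆ P' → Disjoint X B → (∀ b ∈ B, b ∉ S) →
      (∀ a ∈ X, ∀ b ∈ B, ¬ adj a b) → I (X ∪ B) = I X * J B)
    (hJfac : ∀ X B, X ⊆ P' → B ⊆ P' → Disjoint X B → (∀ b ∈ B, b ∉ S) →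
      (∀ a ∈ X, ∀ b ∈ B, ¬ adj a b) → J (X ∪ B) = J X * J B) :
    |(∑ Q ∈ P.powerset, J Q) * (∑ Q ∈ P'.powerset, I Q) -
        (∑ Q ∈ P.powerset, I Q) * (∑ Q ∈ P'.powerset, J Q)| ≤
      (∑ A ∈ P'.powerset with (IsSeeded adj S A ∧ ¬ A ⊆ P),
          ∑ XY ∈ (A.powerset ×ˢ A.powerset) with XY.1 ∪ XY.2 = A,
            |J XY.1 * I XY.2 - I XY.1 * J XY.2|) *
        ((∑ Q ∈ P.powerset, J Q) * ∑ Q ∈ P'.powerset, J Q) := by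
  set comp : Finset ι × Finset ι → Finset ι := fun QQ => seededComponent adj S (QQ.1 ∪ QQ.2)
    with hcomp
  set τ : Finset ι × Finset ι → ℝ := fun XY => J XY.1 * I XY.2 - I XY.1 * J XY.2 with hτ
  set pairs := P.powerset ×ˢ P'.powerset with hpairs
  have hmem_pairs : ∀ {QQ}, QQ ∈ pairs → QQ.1 ⊆ P ∧ QQ.2 ⊆ P' := fun h => by
    simpa only [hpairs, mem_product, mem_powerset] using h
  have hunion : ∀ {QQ}, QQ ∈ pairs → QQ.1 ∪ QQ.2 ⊆ P' := fun h =>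
    union_subset ((hmem_pairs h).1.trans hPP') (hmem_pairs h).2
  -- Step 1: double expansion
  have hexp : (∑ Q ∈ P.powerset, J Q) * (∑ Q ∈ P'.powerset, I Q) -
      (∑ Q ∈ P.powerset, I Q) * (∑ Q ∈ P'.powerset, J Q) = ∑ QQ ∈ pairs, τ QQ := by
    rw [sum_mul_sum, sum_mul_sum, ← sum_product', ← sum_product', ← sum_sub_distrib]
  -- Step 2: factorisation of each term through the joint seeded component
  have hfac : ∀ QQ ∈ pairs, τ QQ =
      τ (QQ.1 ∩ comp QQ, QQ.2 ∩ comp QQ) * (J (QQ.1 \ comp QQ) * J (QQ.2 \ comp QQ)) := by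
    intro QQ hQQ
    have hU := hunion hQQ
    have e1 := apply_eq_mul_of_factor (adj := adj) hJfac (subset_union_left (s₂ := QQ.2)) hU
    have e2 := apply_eq_mul_of_factor (adj := adj) hIfac (subset_union_right (s₁ := QQ.1)) hU
    have e3 := apply_eq_mul_of_factor (adj := adj) hIfac (subset_union_left (s₂ := QQ.2)) hU
    have e4 := apply_eq_mul_of_factor (adj := adj) hJfac (subset_union_right (s₁ := QQ.1)) hU
    simp only [hτ]
    rw [e1, e2, e3, e4]
    ring
  -- Step 3: the swap of the seeded parts
  set g : Finset ι × Finset ι → Finset ι × Finset ι := fun QQ =>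
    (QQ.2 ∩ comp QQ ∪ QQ.1 \ comp QQ, QQ.1 ∩ comp QQ ∪ QQ.2 \ comp QQ) with hg
  have hg_comp : ∀ QQ, comp (g QQ) = comp QQ := fun QQ => by
    simp only [hg, hcomp, inter_union_sdiff_swap_union]
  have hg_fst_inter : ∀ QQ, (g QQ).1 ∩ comp QQ = QQ.2 ∩ comp QQ := fun QQ =>
    inter_union_sdiff_swap_inter _ _ _
  have hg_snd_inter : ∀ QQ, (g QQ).2 ∩ comp QQ = QQ.1 ∩ comp QQ := fun QQ =>
    inter_union_sdiff_swap_inter _ _ _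
  have hg_fst_sdiff : ∀ QQ, (g QQ).1 \ comp QQ = QQ.1 \ comp QQ := fun QQ =>
    inter_union_sdiff_swap_sdiff _ _ _
  have hg_snd_sdiff : ∀ QQ, (g QQ).2 \ comp QQ = QQ.2 \ comp QQ := fun QQ =>
    inter_union_sdiff_swap_sdiff _ _ _
  have hg_inv : ∀ QQ, g (g QQ) = QQ := fun QQ => by
    refine Prod.ext ?_ ?_
    · show (g QQ).2 ∩ comp (g QQ) ∪ (g QQ).1 \ comp (g QQ) = QQ.1
      rw [hg_comp, hg_snd_inter, hg_fst_sdiff]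
      exact sup_inf_sdiff QQ.1 (comp QQ)
    · show (g QQ).1 ∩ comp (g QQ) ∪ (g QQ).2 \ comp (g QQ) = QQ.2
      rw [hg_comp, hg_fst_inter, hg_snd_sdiff]
      exact sup_inf_sdiff QQ.2 (comp QQ)
  -- interior pairs are mapped to interior pairs
  set inner := pairs.filter fun QQ => comp QQ ⊆ P with hinner
  have hg_mem : ∀ QQ ∈ inner, g QQ ∈ inner := by
    intro QQ hQQ
    rw [hinner, mem_filter] at hQQ ⊢
    obtain ⟨hQQp, hA⟩ := hQQ
    obtain ⟨h1, h2⟩ := hmem_pairs hQQp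
    refine ⟨?_, by rw [hg_comp]; exact hA⟩
    rw [hpairs, mem_product, mem_powerset, mem_powerset]
    exact ⟨union_subset (inter_subset_right.trans hA) (sdiff_subset.trans h1),
      union_subset (inter_subset_left.trans (h1.trans hPP')) (sdiff_subset.trans h2)⟩
  have hinner_pairs : ∀ QQ ∈ inner, QQ ∈ pairs := fun QQ hQQ => (mem_filter.mp hQQ).1
  -- the swap reverses the sign of the term
  have hg_neg : ∀ QQ ∈ inner, τ QQ + τ (g QQ) = 0 := by
    intro QQ hQQ
    rw [hfac QQ (hinner_pairs QQ hQQ), hfac (g QQ) (hinner_pairs _ (hg_mem QQ hQQ)), hg_comp,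
      hg_fst_inter, hg_snd_inter, hg_fst_sdiff, hg_snd_sdiff]
    simp only [hτ]
    ring
  have hinner_zero : ∑ QQ ∈ inner, τ QQ = 0 := by
    refine sum_involution (fun QQ _ => g QQ) hg_neg (fun QQ hQQ hne heq => hne ?_) hg_mem
      (fun QQ _ => hg_inv QQ)
    have := hg_neg QQ hQQ
    rw [heq] at this
    linarith
  -- Step 4: the boundary pairs
  set outer := pairs.filter fun QQ => ¬ comp QQ ⊆ P with houter
  set Tb := P'.powerset.filter fun A => IsSeeded adj S A ∧ ¬ A ⊆ P with hTb
  set XYs : Finset ι → Finset (Finset ι × Finset ι) := fun A =>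
    (A.powerset ×ˢ A.powerset).filter fun XY => XY.1 ∪ XY.2 = A with hXYs
  set ZZ := (∑ Q ∈ P.powerset, J Q) * ∑ Q ∈ P'.powerset, J Q with hZZ
  have houter_pairs : ∀ QQ ∈ outer, QQ ∈ pairs := fun QQ hQQ => (mem_filter.mp hQQ).1
  have hmaps : ∀ QQ ∈ outer, comp QQ ∈ Tb := by
    intro QQ hQQ
    rw [houter, mem_filter] at hQQ
    rw [hTb, mem_filter, mem_powerset]
    exact ⟨(seededComponent_subset adj S _).trans (hunion hQQ.1),
      isSeeded_seededComponent adj S _, hQQ.2⟩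
  have hJJ : ∀ QQ ∈ pairs, 0 ≤ J (QQ.1 \ comp QQ) * J (QQ.2 \ comp QQ) := fun QQ hQQ =>
    mul_nonneg (hJ _ (sdiff_subset.trans ((hmem_pairs hQQ).1.trans hPP')))
      (hJ _ (sdiff_subset.trans (hmem_pairs hQQ).2))
  -- the fibre over a boundary component `A`
  have hfibre : ∀ A ∈ Tb,
      ∑ QQ ∈ outer with comp QQ = A, |τ QQ| ≤ (∑ XY ∈ XYs A, |τ XY|) * ZZ := by
    intro A _
    set fib := outer.filter fun QQ => comp QQ = A with hfib
    set φ : Finset ι × Finset ι → (Finset ι × Finset ι) × (Finset ι × Finset ι) := fun QQ =>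
      ((QQ.1 ∩ A, QQ.2 ∩ A), (QQ.1 \ A, QQ.2 \ A)) with hφ
    set H : (Finset ι × Finset ι) × (Finset ι × Finset ι) → ℝ := fun z =>
      |τ z.1| * (J z.2.1 * J z.2.2) with hH
    have hfib_mem : ∀ {QQ}, QQ ∈ fib → QQ ∈ pairs ∧ comp QQ = A := fun h => by
      rw [hfib, mem_filter] at h
      exact ⟨houter_pairs _ h.1, h.2⟩
    have hH_eq : ∀ QQ ∈ fib, |τ QQ| = H (φ QQ) := by
      intro QQ hQQ
      obtain ⟨hp, hA⟩ := hfib_mem hQQ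
      have hnn := hJJ QQ hp
      rw [hfac QQ hp, abs_mul, abs_of_nonneg hnn, hA]
    have hQA : ∀ Q : Finset ι, Q ∩ A ∪ Q \ A = Q := fun Q => sup_inf_sdiff Q A
    have hinj : Set.InjOn φ ↑fib := by
      intro QQ₁ _ QQ₂ _ heq
      simp only [hφ, Prod.mk.injEq] at heq
      obtain ⟨⟨h11, h12⟩, h21, h22⟩ := heq
      refine Prod.ext ?_ ?_
      · rw [← hQA QQ₁.1, ← hQA QQ₂.1, h11, h21]
      · rw [← hQA QQ₁.2, ← hQA QQ₂.2, h12, h22]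
    have himage : fib.image φ ⊆ XYs A ×ˢ (P.powerset ×ˢ P'.powerset) := by
      intro z hz
      obtain ⟨QQ, hQQ, rfl⟩ := mem_image.mp hz
      obtain ⟨hp, hA⟩ := hfib_mem hQQ
      obtain ⟨h1, h2⟩ := hmem_pairs hp
      have hAU : A ⊆ QQ.1 ∪ QQ.2 := hA ▸ seededComponent_subset adj S _
      simp only [hφ, hXYs, mem_product, mem_filter, mem_powerset]
      refine ⟨⟨⟨inter_subset_right, inter_subset_right⟩, ?_⟩, sdiff_subset.trans h1,
        sdiff_subset.trans h2⟩
      rw [← union_inter_distrib_right]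
      exact inter_eq_right.mpr hAU
    have hH0 : ∀ z ∈ XYs A ×ˢ (P.powerset ×ˢ P'.powerset), 0 ≤ H z := by
      intro z hz
      simp only [mem_product, mem_powerset] at hz
      exact mul_nonneg (abs_nonneg _)
        (mul_nonneg (hJ _ (hz.2.1.trans hPP')) (hJ _ hz.2.2))
    calc ∑ QQ ∈ fib, |τ QQ| = ∑ QQ ∈ fib, H (φ QQ) := sum_congr rfl hH_eq
      _ = ∑ z ∈ fib.image φ, H z := (sum_image hinj).symm
      _ ≤ ∑ z ∈ XYs A ×ˢ (P.powerset ×ˢ P'.powerset), H z :=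
          sum_le_sum_of_subset_of_nonneg himage fun z hz _ => hH0 z hz
      _ = (∑ XY ∈ XYs A, |τ XY|) * ZZ := by
          rw [hZZ, sum_mul_sum, ← sum_product', sum_mul_sum, ← sum_product']
  -- Step 5: conclusion
  have hsplit : ∑ QQ ∈ pairs, τ QQ = ∑ QQ ∈ inner, τ QQ + ∑ QQ ∈ outer, τ QQ :=
    (sum_filter_add_sum_filter_not pairs (fun QQ => comp QQ ⊆ P) τ).symm
  calc |(∑ Q ∈ P.powerset, J Q) * (∑ Q ∈ P'.powerset, I Q) -
        (∑ Q ∈ P.powerset, I Q) * (∑ Q ∈ P'.powerset, J Q)|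
      = |∑ QQ ∈ outer, τ QQ| := by rw [hexp, hsplit, hinner_zero, zero_add]
    _ ≤ ∑ QQ ∈ outer, |τ QQ| := abs_sum_le_sum_abs _ _
    _ = ∑ A ∈ Tb, ∑ QQ ∈ outer with comp QQ = A, |τ QQ| :=
        (sum_fiberwise_of_maps_to hmaps _).symm
    _ ≤ ∑ A ∈ Tb, (∑ XY ∈ XYs A, |τ XY|) * ZZ := sum_le_sum hfibre
    _ = (∑ A ∈ Tb, ∑ XY ∈ XYs A, |τ XY|) * ZZ := by rw [sum_mul]

open scoped Classical in
/-- **Two-volume comparison for the ratios.** Under the hypotheses of `abs_sub_le_of_factor`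
and with positive normalisations `Z_P, Z_{P'} > 0`:
`|N_{P'}/Z_{P'} - N_P/Z_P| ≤ ∑_{A ⊆ P' seeded, A ⊄ P} ∑_{X ∪ Y = A} |J X I Y - I X J Y|`. [folklore] -/
theorem abs_div_sub_div_le_of_factor (P P' S : Finset ι) (hPP' : P ⊆ P') (I J : Finset ι → ℝ)
    (hJ : ∀ B ⊆ P', 0 ≤ J B)
    (hIfac : ∀ X B, X ⊆ P' → B ⊆ P' → Disjoint X B → (∀ b ∈ B, b ∉ S) →
      (∀ a ∈ X, ∀ b ∈ B, ¬ adj a b) → I (X ∪ B) = I X * J B)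
    (hJfac : ∀ X B, X ⊆ P' → B ⊆ P' → Disjoint X B → (∀ b ∈ B, b ∉ S) →
      (∀ a ∈ X, ∀ b ∈ B, ¬ adj a b) → J (X ∪ B) = J X * J B)
    (hZ : 0 < ∑ Q ∈ P.powerset, J Q) (hZ' : 0 < ∑ Q ∈ P'.powerset, J Q) :
    |(∑ Q ∈ P'.powerset, I Q) / (∑ Q ∈ P'.powerset, J Q) -
        (∑ Q ∈ P.powerset, I Q) / (∑ Q ∈ P.powerset, J Q)| ≤
      ∑ A ∈ P'.powerset with (IsSeeded adj S A ∧ ¬ A ⊆ P),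
        ∑ XY ∈ (A.powerset ×ˢ A.powerset) with XY.1 ∪ XY.2 = A,
          |J XY.1 * I XY.2 - I XY.1 * J XY.2| := by
  have h := abs_sub_le_of_factor (adj := adj) P P' S hPP' I J hJ hIfac hJfac
  rw [div_sub_div _ _ hZ'.ne' hZ.ne', abs_div, abs_of_pos (mul_pos hZ' hZ),
    div_le_iff₀ (mul_pos hZ' hZ)]
  calc |(∑ Q ∈ P'.powerset, I Q) * (∑ Q ∈ P.powerset, J Q) -
        (∑ Q ∈ P'.powerset, J Q) * (∑ Q ∈ P.powerset, I Q)|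
      = |(∑ Q ∈ P.powerset, J Q) * (∑ Q ∈ P'.powerset, I Q) -
          (∑ Q ∈ P.powerset, I Q) * (∑ Q ∈ P'.powerset, J Q)| := by ring_nf
    _ ≤ _ := h
    _ = _ := by ring

end TwoVolume

end Literature.MathematicalPhysics.QuantumFieldTheory.Polymer
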